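import Summits.BirchSwinnertonDyer.BirchSwinnertonDyer.Theorems.ShadowIsolationIsolationOfAccidentalZerosStubRationalSectorFinite
import HarnessLib

/-!
# BirchSwinnertonDyer / ShadowIsolation — crux `ShaCotorsionReducible` (stmt-BirchSwinnertonDyer-15277),
# line `eisenstein-shadow`, stub F_red: the RATIONAL sub-sector reduces to ONE missing statement

Stub F_red (`stub_finiteShadowsAtOneDepthReducible`) of the reshaped skeleton
`Cruxes/ShaCotorsionReducible/Lines/eisenstein_shadow.lean` asks, on the Eisenstein (reducible) sector, for
a depth `n` at which the accidental-zero data `(M, g)` form a finite set. For the IRREDUCIBLE twin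
(crux stmt-BirchSwinnertonDyer-15786) the members with INTEGRAL `q`-expansion are finite at depth `2` by
`Theorems.stub_rationalSectorFinite`, whose two inputs are the Eichler–Shimura construction and the
named fact `DeepCongruenceFinite` (Carayol + Faltings), and the latter CONSUMES the irreducibility of
`E[p]` (Carayol's theorem needs it).

This file records, sorry-free, that irreducibility enters ONLY there: the bookkeeping of
`stub_rationalSectorFinite` is sector-free (`stubF_exists_curve_of_congruent`,
`stubF_sigma_mk_eq_of_qExpansion_coeff_eq`), so the rational sub-sector of F_red follows from the
Eichler–Shimura construction and the following statement `DC_red`, taken here as an explicit HYPOTHESIS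
(it is NOT a tree fact and NOT in print — it is the exact missing engine, displayed for the planners):

  `DC_red`: for `W/ℚ` globally minimal elliptic and `p ≥ 5` good ordinary with `E[p]` reducible there is a
  depth `n` such that the `L`-coefficient systems of elliptic curves `E'/ℚ` with `a_ℓ(E') ≡ a_ℓ(W)
  (mod pⁿ)` for all but finitely many primes `ℓ` form a finite set.

Why `DC_red` is plausible (lead c4, NOTES.md §F_red; not formalised): for a residually reducible,
multiplicity-free `ρ̄ = ψ₁ ⊕ ψ₂` (`ψ₁ψ₂ = ω`, `ψ₁ ≠ ψ₂`), equality of traces modulo `p²` makes the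
pseudocharacter of `E'[p²]` equal to that of `W[p²]`; when the latter is a sum of two characters
(e.g. `W = X₀(11)`, `p = 5`, split `E[5] = ℤ/5 ⊕ μ₅`) Bellaïche–Chenevier's reducibility ideal forces
`E'[5]` split or a rational cyclic `25`-isogeny on `E'`, in both cases with the diagonal character modulo
`25` PINNED to that of `W`, so that a `5`- or `25`-isogenous curve of `E'` is a rational point of a fixed
twist of `X₁(25)` (genus `12`), and Faltings gives finiteness; the non-split case needs the same analysis
one level deeper. None of this is a theorem in print, hence the hypothesis.
-/

set_option linter.dupNamespace false

noncomputable section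

namespace Summit.BirchSwinnertonDyer.BirchSwinnertonDyer.Theorems

open scoped MatrixGroups ModularForm
open CongruenceSubgroup UpperHalfPlane
open Literature.NumberTheory.EllipticCurves Literature.NumberTheory.EllipticCurves.ModularForms

/-- **F_red, rational sub-sector, modulo `DC_red`.** Given the Eichler–Shimura construction
(`eichlerShimuraConstruction`, Knapp 1993 Thm. 11.74 with Carayol) and — as an explicit hypothesis — a
reducible-sector deep-congruence finiteness at SOME depth (`DC_red`, not in print), on the Eisenstein
sector there is a depth `n` at which the pairs `(M, g)` — `M` squarefree coprime to `p·N_W`,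
`g ∈ S₂(Γ₀(N_W·M))` a newform with INTEGRAL `q`-expansion, depth-`n` congruent to `W` at the primes
`ℓ ∤ N_W·M` — form a finite set: the coefficient map `(M, g) ↦ (aₘ(g))ₘ` is injective on newforms
(`stubF_sigma_mk_eq_of_qExpansion_coeff_eq`, strong multiplicity one) and lands in the complexification
of the finite set of `DC_red` (`stubF_exists_curve_of_congruent`). Irreducibility of `E[p]` is used
nowhere else in the sibling proof `stub_rationalSectorFinite`. [cite: Knapp1993, Thm. 11.74 and Thm. 12.8]
[cite: AtkinLehner1970, Thm. 4] -/
theorem finiteRationalShadowsReducible_of_deepCongruenceFiniteReducible : Literature.NumberTheory.EllipticCurves.ModularForms.eichlerShimuraConstruction → (∀ (W : WeierstrassCurve ℚ) [W.IsElliptic] [W.IsGloballyMinimal] (p : ℕ) [Fact p.Prime], 5 ≤ p → W.HasGoodReductionAtPrime p → ¬ (p : ℤ) ∣ W.frobeniusTrace p → ¬ W.HasIrreducibleModPGaloisRep p → ∃ n : ℕ, Set.Finite {a : ℕ → ℤ | ∃ (W' : WeierstrassCurve ℚ) (_ : W'.IsElliptic), (∀ m : ℕ, a m = W'.LFunction m)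 ∧ {ℓ : ℕ | ℓ.Prime ∧ ¬ ((p : ℤ) ^ n ∣ W'.LFunction ℓ - W.LFunction ℓ)}.Finite}) → ∀ (W : WeierstrassCurve ℚ) [W.IsElliptic] [W.IsGloballyMinimal] (p : ℕ) [Fact p.Prime], 5 ≤ p → W.HasGoodReductionAtPrime p → ¬ (p : ℤ) ∣ W.frobeniusTrace p → ¬ W.HasIrreducibleModPGaloisRep p → ∃ n : ℕ, Set.Finite {x : Σ M : ℕ, CuspForm (CongruenceSubgroup.Gamma0 (W.conductorNorm ℤ * M)) 2 | ∃ (_ : NeZero (W.conductorNorm ℤ * x.1)) (R : Subring ℂ) (φ : R →+* ZMod (p ^ n)) (hR : ∀ ℓ : ℕ, ℓ.Prime → ¬ ℓ ∣ W.conductorNorm ℤ * x.1 → Literature.NumberTheory.EllipticCurves.ModularForms.heckeEigenvalue x.2 ℓ ∈ R), (∀ m : ℕ, ∃ a : ℤ, (UpperHalfPlane.qExpansion 1 ⇑(x.2)).coeff m = (a : ℂ)) ∧ Squarefree x.1 ∧ Nat.Coprime x.1 (p * W.conductorNorm ℤ) ∧ Literature.NumberTheory.EllipticCurves.ModularForms.IsNewform0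 x.2 ∧ (∀ (ℓ : ℕ) (hℓ : ℓ.Prime) (hℓL : ¬ ℓ ∣ W.conductorNorm ℤ * x.1), φ ⟨Literature.NumberTheory.EllipticCurves.ModularForms.heckeEigenvalue x.2 ℓ, hR ℓ hℓ hℓL⟩ = ((W.frobeniusTrace ℓ : ℤ) : ZMod (p ^ n)))} := by
  intro hES hDCred W _ _ p _ hp5 hgood hord hred
  have hN : W.conductorNorm ℤ ≠ 0 := (WeierstrassCurve.conductorNorm_pos_holds W).ne'
  obtain ⟨n, hF⟩ := hDCred W p hp5 hgood hord hred
  refine ⟨n, ?_⟩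
  refine Set.Finite.of_finite_image (f := fun x m ↦ (qExpansion 1 ⇑x.2).coeff m) ?_ ?_
  · -- the image lies in the complexification of the finite set of `DC_red`
    refine (hF.image fun (a : ℕ → ℤ) (m : ℕ) ↦ (a m : ℂ)).subset ?_
    rintro _ ⟨⟨M, g⟩, ⟨inst, R, φ, hR, hint, -, -, hg, hcong⟩, rfl⟩
    obtain ⟨W', hW'ell, hcoeff, hfin⟩ :=
      stubF_exists_curve_of_congruent hES W p n M hg hint R φ hR hcong
    exact ⟨fun m ↦ W'.LFunction m, ⟨W', hW'ell, fun _ ↦ rfl, hfin⟩,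
      funext fun m ↦ (hcoeff m).symm⟩
  · -- the coefficient map is injective on newforms (strong multiplicity one)
    rintro ⟨M, g⟩ ⟨inst, -, -, -, -, -, -, hg, -⟩ ⟨M', g'⟩ ⟨inst', -, -, -, -, -, -, hg', -⟩ hqq
    exact stubF_sigma_mk_eq_of_qExpansion_coeff_eq hN hg hg' fun m ↦ congr_fun hqq m

end Summit.BirchSwinnertonDyer.BirchSwinnertonDyer.Theorems

end
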